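import Summits.QuantumFields.BalabanUV.Beta.FP.CoarseCovarianceStripReg
import Summits.QuantumFields.BalabanUV.Beta.FP.CoarseCovarianceEllipticBound

/-!
# `BalabanUV.Beta.FP.CoarseCovarianceStripBn` — road «FP» (binder row D1), row H′2-IR ∕ IR-2 (ii), file (ii) part 4: **THE FACTOR `B_n = 1 + E_n`
# IS INVERTIBLE WITH n-UNIFORMLY BOUNDED INVERSE ON THE THIN COMPLEX STRIP `Strip D κ_C`** — `κ_C = kapC d`, `‖B_n(k)⁻¹‖_{αβ} ≤ CB d`
# (`d`-only constants), for every `n ≥ 1` and every `k` with `|Re k_i| ≤ π`, `|Im k_i| ≤ κ_C`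

HONEST FRAMING (cell contract, verbatim): «discharging `BetaPertH` makes Bałaban's UV stability UNCONDITIONAL — a real constructive-QFT
result; it is NOT the continuum limit and NOT the Clay problem.»  HONEST DEPENDENCY (verbatim): «continuum YM on T⁴ ⇐ BetaPertH ∧ nine
spine estimates (0/9 proved); BetaPertH ⇐ (D1) ∧ (D4) ∧ CAP+tail; G-an2-4 gates asym, D1 and NE2/3/4.»  THIS MODULE DISCHARGES NOTHING of
D1 ∕ BetaPertH: [folklore] finite-dimensional perturbation theory over files (ii)(Reg)(M) of this row and leaf-02-g7's REAL-ZONE ELLIPTICITY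
`CoarseCovarianceEllipticBound.re_quad_covSymMean_PbfSym_ge` (p238458) BY NAME.  Four [our object] CONSTANT defs (`cE`, `CB0`, `kapC`, `CB`,
`d`-only); no `def … : Prop`; nothing is cited; 0 sorry.  NOT summit progress; NOT BetaPertH, NOT continuum, NOT Clay.

ABSOLUTE RULE (cell, verbatim): «No internally-minted statement may enter as a cited fact. Every hypothesis is either kernel-proved in this
package or a verbatim quotation of a PUBLISHED theorem with page reference. The manuscript(s) under audit are NOT citable for their own
disputed steps — they are the thing under adjudication; programme-internal (2001/route/tribunal) claims are never citable.»

THE ARGUMENT (no near∕away split): at EVERY real zone point `t ≠ 0` the structure identity of file (ii) gives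
`B_n(t)⁻¹ = N⁻¹ • Dwm₀·Chol(t)⁻¹·Dw₀·PC(t/n)`; leaf-02's ellipticity gives `‖Chol(t)⁻¹‖ ≤ ‖t‖²·n^{D}/(cE·n²)`, the cone theorem gives
`‖PC(t/n)‖ ≤ CP·n²/‖t‖²`, the real weights are `≤ n^{D+1}` — the factors `‖t‖²` and all powers of `n` CANCEL: `‖B_n(t)⁻¹‖_{αβ} ≤ D·CP/cE`
(and `B_n(0) = 1`).  Then `B_n(k) = B_n(Re k)·(1 + B_n(Re k)⁻¹(E_n(k) − E_n(Re k)))` with `‖E_n(k) − E_n(Re k)‖ ≤ (ME/rA)·D·κ_C` (file (Reg)),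
and Neumann (file (M)) on the thin strip.

CONTENT (`D = d+1`).
* §1 real points: `cE`, `ofRealVec_mem_Fat`, `Chol_ofRealVec` (`Chol n t = Ĉ_n^{BF,mean}(t)`, leaf-02's literal), **`Chol_coercive`**,
  `redist_ofRealVec`, `norm_apt_zero`, **`PC_real_bound`**, `CB0`, **`Bn_inv_real`** (`IsUnit ∧ ‖B_n(t)⁻¹‖_{αβ} ≤ CB0 d`, every `t ∈ [−π,π]^D`).
* §2 the thin strip: `kapC`, `CB`, **`Bn_inv_bound`** (`IsUnit (Bn n k).det ∧ ‖(Bn n k)⁻¹ α β‖ ≤ CB d` for `k ∈ Strip D κ_C`).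
Unit `b2b-balaban-beta-d1-formalise-leaf-06` (gen 8), owner ruling R-FP-21 (A3)∕(C).
-/

noncomputable section

namespace Summit.QuantumFields.BalabanUV.Beta.FP.CoarseCovarianceStripBn

open Finset Complex Set Metric Matrix
open scoped BigOperators ComplexConjugate
open Literature.MathematicalPhysics.QuantumFieldTheory.Balaban1983to89
open B4Strip (Strip ofRealVec reVec)
open B4StripCauchy (Fat)
open B4ContourShift (BZ)
open Beta.FibreInverseDecay (reVec_mem_BZ)
open Summit.QuantumFields.BalabanUV.Beta.GAN24.AliasTiling (apt)
open Summit.QuantumFields.BalabanUV.Beta.GAN24.AliasDecimate (aliasPt aliasPt_ofRealVec)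
open Summit.QuantumFields.BalabanUV.Beta.GAN24.PushSumSymbol (cweight)
open Summit.QuantumFields.BalabanUV.Beta.FP.PerfectPropagatorSymbol (quad)
open Summit.QuantumFields.BalabanUV.Beta.FP.CoarseCovarianceAlias (covSymMean covSymMean_apply norm_cweight_ofRealVec_le cweight_neg_ofRealVec)
open Summit.QuantumFields.BalabanUV.Beta.FP.CoarseCovarianceAliasBF (PbfSym reVec_ofRealVec)
open Summit.QuantumFields.BalabanUV.Beta.FP.CoarseCovarianceEllipticBound (apt_zero_mem_BZ apt_zero_apply norm_wrapPt_of_mem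
  re_quad_covSymMean_PbfSym_ge cEll_pos)
open Summit.QuantumFields.BalabanUV.Beta.FP.CoarseCovarianceStripW
open Summit.QuantumFields.BalabanUV.Beta.FP.CoarseCovarianceStripFeyn
open Summit.QuantumFields.BalabanUV.Beta.FP.CoarseCovarianceStripMatrix
open Summit.QuantumFields.BalabanUV.Beta.FP.CoarseCovarianceStripProp
open Summit.QuantumFields.BalabanUV.Beta.FP.CoarseCovarianceStripPropCone
open Summit.QuantumFields.BalabanUV.Beta.FP.CoarseCovarianceStripAlias
open Summit.QuantumFields.BalabanUV.Beta.FP.CoarseCovarianceStripAliasWeights (aliasPt_apply' aliasPt_im)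
open Summit.QuantumFields.BalabanUV.Beta.FP.CoarseCovarianceStrip
open Summit.QuantumFields.BalabanUV.Beta.FP.CoarseCovarianceStripBound
open Summit.QuantumFields.BalabanUV.Beta.FP.CoarseCovarianceStripReg

variable {d : ℕ}

/-! ## §1 Real points: the inverse of `Bn` is n-uniformly bounded at every real zone momentum -/

/-- [our object] leaf-02-g7's ellipticity constant `cE := (2/π)^{2d+4}/((π²/4)^{2(d+1)+4}(d+1))` (inline in `re_quad_covSymMean_PbfSym_ge`). -/
def cE (d : ℕ) : ℝ := (2 / Real.pi) ^ (2 * d + 4) / ((Real.pi ^ 2 / 4) ^ (2 * (d + 1) + 4) * ((d : ℝ) + 1))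

/-- [folklore] `0 < cE`. -/
theorem cE_pos (d : ℕ) : 0 < cE d := by unfold cE; exact cEll_pos d

/-- [folklore] a real zone point is a fat point (zero imaginary parts). -/
theorem ofRealVec_mem_Fat {s : Fin (d + 1) → ℝ} (hs : s ∈ BZ (d + 1)) {r : ℝ} (hr : 0 ≤ r) : ofRealVec s ∈ Fat (d + 1) r := by
  intro i
  unfold BZ at hs
  rw [Set.mem_Icc] at hs
  have h1 := hs.1 i
  have h2 := hs.2 i
  refine ⟨?_, ?_⟩
  · simp only [ofRealVec, Complex.ofReal_re]
    exact (abs_le.mpr ⟨h1, h2⟩).trans (by linarith)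
  · simp only [ofRealVec, Complex.ofReal_im, abs_zero]
    linarith

/-- [our object] **AT A REAL COARSE MOMENTUM `Chol` IS LEAF-02-g7's LITERAL**: `Chol n t κ λ = covSymMean n κ λ (PbfSym κ λ) t`
(the alias points of a real `t` are real, where `PC = PbfSym` by file (F)). -/
theorem Chol_ofRealVec (n : ℕ) [NeZero n] (t : Fin (d + 1) → ℝ) (κ lam : Fin (d + 1)) :
    Chol n (ofRealVec t) κ lam = covSymMean n κ lam (PbfSym κ lam) (ofRealVec t) := by
  rw [Chol_apply, covSymMean_apply, covSymMean_apply]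
  congr 1
  refine Finset.sum_congr rfl fun a _ => ?_
  rw [aliasPt_ofRealVec, PC_ofRealVec]

/-- [our object] **REAL-ZONE COERCIVITY OF `Chol`** (leaf-02-g7's `re_quad_covSymMean_PbfSym_ge` BY NAME): for `t ∈ [−π,π]^D`, `t ≠ 0`,
`cE·(n²/n^D)/‖t‖²·Σ‖w‖² ≤ Re quad (Chol n t) w`. -/
theorem Chol_coercive (n : ℕ) [NeZero n] {t : Fin (d + 1) → ℝ} (ht : t ∈ BZ (d + 1)) (ht0 : t ≠ 0) (w : Fin (d + 1) → ℂ) :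
    cE d * ((n : ℝ) ^ 2 / (n : ℝ) ^ (d + 1)) / ‖t‖ ^ 2 * ∑ α, ‖w α‖ ^ 2 ≤ (quad (Chol n (ofRealVec t)) w).re := by
  have h := re_quad_covSymMean_PbfSym_ge n ht ht0 w
  unfold quad cE
  simp only [Chol_ofRealVec]
  exact h

/-- [folklore] the reduced distance of a real zone point is its sup norm. -/
theorem redist_ofRealVec {s : Fin (d + 1) → ℝ} (hs : s ∈ BZ (d + 1)) : redist (ofRealVec s) = ‖s‖ := by
  unfold redist
  rw [wrapC_ofRealVec, reVec_ofRealVec, norm_wrapPt_of_mem hs]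

/-- [folklore] `‖t/n‖ = ‖t‖/n`. -/
theorem norm_apt_zero (n : ℕ) [NeZero n] (t : Fin (d + 1) → ℝ) : ‖apt n (fun _ => (0 : Fin n)) t‖ = ‖t‖ / n := by
  have hn0 : (0 : ℝ) < n := by exact_mod_cast Nat.pos_of_ne_zero (NeZero.ne n)
  have e : apt n (fun _ => (0 : Fin n)) t = (n : ℝ)⁻¹ • t := by
    funext i; rw [apt_zero_apply, Pi.smul_apply, smul_eq_mul, div_eq_inv_mul]
  rw [e, norm_smul, Real.norm_eq_abs, abs_of_pos (inv_pos.mpr hn0), div_eq_inv_mul]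

/-- [our object] **THE PERFECT PROPAGATOR SYMBOL AT `t/n` FOR A REAL ZONE MOMENTUM `t ≠ 0`**: invertible, `‖PC(t/n) α β‖ ≤ CP·n²/‖t‖²`. -/
theorem PC_real_bound (n : ℕ) [NeZero n] {t : Fin (d + 1) → ℝ} (ht : t ∈ BZ (d + 1)) (ht0 : t ≠ 0) :
    IsUnit (feynC (aliasPt n (fun _ => (0 : Fin n)) (ofRealVec t))).det ∧
    ∀ α β, ‖PC (aliasPt n (fun _ => (0 : Fin n)) (ofRealVec t)) α β‖ ≤ CP d * (n : ℝ) ^ 2 / ‖t‖ ^ 2 := by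
  have hn0 : (0 : ℝ) < n := by exact_mod_cast Nat.pos_of_ne_zero (NeZero.ne n)
  rw [aliasPt_ofRealVec]
  have hs : apt n (fun _ => (0 : Fin n)) t ∈ BZ (d + 1) := apt_zero_mem_BZ n ht
  have hred : redist (ofRealVec (apt n (fun _ => (0 : Fin n)) t)) = ‖t‖ / n := by rw [redist_ofRealVec hs, norm_apt_zero]
  have htn : 0 < ‖t‖ := norm_pos_iff.mpr ht0
  have hpos : 0 < redist (ofRealVec (apt n (fun _ => (0 : Fin n)) t)) := by rw [hred]; positivity
  obtain ⟨hU, hb⟩ := PC_bound_cone (p := ofRealVec (apt n (fun _ => (0 : Fin n)) t))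
    (fun i => by simp only [ofRealVec, Complex.ofReal_im, abs_zero]; exact (kap0_pos d).le)
    (fun i => by simp only [ofRealVec, Complex.ofReal_im, abs_zero]; exact mul_nonneg (cone_pos d).le (redist_nonneg _)) hpos
  refine ⟨hU, fun α β => (hb α β).trans (le_of_eq ?_)⟩
  rw [hred]
  field_simp

/-- [our object] the real-point constant `CB0 := 1 + D·CP/cE`. -/
def CB0 (d : ℕ) : ℝ := 1 + ((d : ℝ) + 1) * CP d / cE d

/-- [folklore] `1 ≤ CB0`. -/
theorem one_le_CB0 (d : ℕ) : 1 ≤ CB0 d := by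
  unfold CB0
  have := CP_pos d
  have := cE_pos d
  have : 0 ≤ ((d : ℝ) + 1) * CP d / cE d := by positivity
  linarith

/-- [our object] **`Bn` AT A REAL ZONE MOMENTUM: INVERTIBLE WITH `‖Bn(t)⁻¹‖_{αβ} ≤ CB0 d`**, every `t ∈ [−π,π]^D`, every `n ≥ 1` (`t = 0`: `Bn = 1`;
`t ≠ 0`: structure identity + ellipticity + cone bound, all powers of `n` and `‖t‖` cancel). -/
theorem Bn_inv_real (n : ℕ) [NeZero n] {t : Fin (d + 1) → ℝ} (ht : t ∈ BZ (d + 1)) :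
    IsUnit (Bn n (ofRealVec t)).det ∧ ∀ α β, ‖(Bn n (ofRealVec t))⁻¹ α β‖ ≤ CB0 d := by
  by_cases ht0 : t = 0
  · subst ht0
    have e : ofRealVec (0 : Fin (d + 1) → ℝ) = (0 : Fin (d + 1) → ℂ) := funext fun i => by simp [ofRealVec]
    rw [e, Bn_zero]
    refine ⟨by simp, fun α β => ?_⟩
    rw [inv_one, Matrix.one_apply]
    have h1 := one_le_CB0 d
    split_ifs
    · rw [norm_one]; exact h1
    · rw [norm_zero]; linarith
  · have hn0 : (0 : ℝ) < n := by exact_mod_cast Nat.pos_of_ne_zero (NeZero.ne n)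
    have htn : 0 < ‖t‖ := norm_pos_iff.mpr ht0
    have hk : ofRealVec t ∈ Fat (d + 1) (rA d) := ofRealVec_mem_Fat ht (rA_pos d).le
    obtain ⟨hF, hPC⟩ := PC_real_bound n ht ht0
    set γ : ℝ := cE d * ((n : ℝ) ^ 2 / (n : ℝ) ^ (d + 1)) / ‖t‖ ^ 2 with hγ
    have hγ0 : 0 < γ := by have := cE_pos d; positivity
    have hcoer : ∀ w : Fin (d + 1) → ℂ, γ * ∑ α, ‖w α‖ ^ 2 ≤ (quad (Chol n (ofRealVec t)) w).re := Chol_coercive n ht ht0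
    have hC : IsUnit (Chol n (ofRealVec t)).det := isUnit_det_of_coercive hγ0 hcoer
    have hCi : ∀ α β, ‖(Chol n (ofRealVec t))⁻¹ α β‖ ≤ 1 / γ := norm_inv_entry_le_of_coercive hγ0 hcoer
    refine ⟨isUnit_Bn_det n hk hF hC, fun α β => ?_⟩
    rw [Bn_inv_eq n hk hF hC, Matrix.smul_apply, smul_eq_mul, norm_mul, norm_inv, norm_pow, Complex.norm_natCast]
    -- the real weights
    have hw : ∀ κ, ‖cweight n κ (aliasPt n (fun _ => (0 : Fin n)) (ofRealVec t))‖ ≤ (n : ℝ) ^ (d + 2) := fun κ => by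
      rw [aliasPt_ofRealVec]; exact norm_cweight_ofRealVec_le n κ _
    have hwm : ∀ lam, ‖cweight n lam (-aliasPt n (fun _ => (0 : Fin n)) (ofRealVec t))‖ ≤ (n : ℝ) ^ (d + 2) := fun lam => by
      rw [aliasPt_ofRealVec, cweight_neg_ofRealVec, Complex.norm_conj]; exact norm_cweight_ofRealVec_le n lam _
    -- the entry of the product
    have hentry : ‖(Dwm n (fun _ => (0 : Fin n)) (ofRealVec t) * (Chol n (ofRealVec t))⁻¹ * Dw n (fun _ => (0 : Fin n)) (ofRealVec t) *
        PC (aliasPt n (fun _ => (0 : Fin n)) (ofRealVec t))) α β‖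
        ≤ ((d : ℝ) + 1) * ((n : ℝ) ^ (d + 2) * (1 / γ) * (n : ℝ) ^ (d + 2) * (CP d * (n : ℝ) ^ 2 / ‖t‖ ^ 2)) := by
      rw [Matrix.mul_apply]
      calc _ ≤ ∑ κ, ‖(Dwm n (fun _ => (0 : Fin n)) (ofRealVec t) * (Chol n (ofRealVec t))⁻¹ * Dw n (fun _ => (0 : Fin n)) (ofRealVec t)) α κ *
              PC (aliasPt n (fun _ => (0 : Fin n)) (ofRealVec t)) κ β‖ := norm_sum_le _ _
        _ ≤ ∑ _κ : Fin (d + 1), (n : ℝ) ^ (d + 2) * (1 / γ) * (n : ℝ) ^ (d + 2) * (CP d * (n : ℝ) ^ 2 / ‖t‖ ^ 2) :=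
            Finset.sum_le_sum fun κ _ => by
              rw [Dw, mul_diagonal, Dwm, diagonal_mul, norm_mul, norm_mul, norm_mul]
              have h1 := hwm α
              have h2 := hCi α κ
              have h3 := hw κ
              have h4 := hPC κ β
              have : ‖cweight n α (-aliasPt n (fun _ => (0 : Fin n)) (ofRealVec t))‖ * ‖(Chol n (ofRealVec t))⁻¹ α κ‖ ≤ (n : ℝ) ^ (d + 2) * (1 / γ) :=
                mul_le_mul h1 h2 (norm_nonneg _) (by positivity)
              exact mul_le_mul (mul_le_mul this h3 (norm_nonneg _) (by positivity)) h4 (norm_nonneg _) (by positivity)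
        _ = _ := by simp only [Finset.sum_const, Finset.card_univ, Fintype.card_fin, nsmul_eq_mul]; push_cast; ring
    have hfinal : ((n : ℝ) ^ (3 * (d + 1) + 2))⁻¹ * (((d : ℝ) + 1) * ((n : ℝ) ^ (d + 2) * (1 / γ) * (n : ℝ) ^ (d + 2) * (CP d * (n : ℝ) ^ 2 / ‖t‖ ^ 2)))
        = ((d : ℝ) + 1) * CP d / cE d := by
      rw [hγ]
      have hc := (cE_pos d).ne'
      field_simp
      ring
    calc ((n : ℝ) ^ (3 * (d + 1) + 2))⁻¹ * _ ≤ ((n : ℝ) ^ (3 * (d + 1) + 2))⁻¹ *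
          (((d : ℝ) + 1) * ((n : ℝ) ^ (d + 2) * (1 / γ) * (n : ℝ) ^ (d + 2) * (CP d * (n : ℝ) ^ 2 / ‖t‖ ^ 2))) :=
          mul_le_mul_of_nonneg_left hentry (by positivity)
      _ = ((d : ℝ) + 1) * CP d / cE d := hfinal
      _ ≤ CB0 d := by unfold CB0; linarith

/-! ## §2 The thin complex strip -/

/-- [our object] the strip width `κ_C := min rA (rA/(2D³·CB0·ME))`. -/
def kapC (d : ℕ) : ℝ := min (rA d) (rA d / (2 * ((d : ℝ) + 1) ^ 3 * CB0 d * ME d))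

/-- [folklore] `0 < κ_C ≤ rA`, and the Neumann budget `D·(D·CB0·(ME/rA·(D·κ_C))) ≤ 1/2`. -/
theorem kapC_pos (d : ℕ) : 0 < kapC d := by
  unfold kapC; have := rA_pos d; have := one_le_CB0 d; have := ME_pos d
  exact lt_min (rA_pos d) (by positivity)

/-- [folklore] `κ_C ≤ rA`. -/
theorem kapC_le_rA (d : ℕ) : kapC d ≤ rA d := min_le_left _ _

/-- [folklore] the Neumann budget `D·(D·CB0·(ME/rA·(D·κ_C))) ≤ 1/2`. -/
theorem kapC_budget (d : ℕ) : ((d : ℝ) + 1) * (((d : ℝ) + 1) * CB0 d * (ME d / rA d * (((d : ℝ) + 1) * kapC d))) ≤ 1 / 2 := by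
  have h := min_le_right (rA d) (rA d / (2 * ((d : ℝ) + 1) ^ 3 * CB0 d * ME d))
  have hr := rA_pos d; have hB := one_le_CB0 d; have hM := ME_pos d
  have hD : (0 : ℝ) < (d : ℝ) + 1 := by positivity
  have e : ((d : ℝ) + 1) * (((d : ℝ) + 1) * CB0 d * (ME d / rA d * (((d : ℝ) + 1) * kapC d))) = kapC d * (((d : ℝ) + 1) ^ 3 * CB0 d * ME d / rA d) := by
    ring
  rw [e]
  calc kapC d * (((d : ℝ) + 1) ^ 3 * CB0 d * ME d / rA d) ≤ (rA d / (2 * ((d : ℝ) + 1) ^ 3 * CB0 d * ME d)) * (((d : ℝ) + 1) ^ 3 * CB0 d * ME d / rA d) :=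
        mul_le_mul_of_nonneg_right h (by positivity)
    _ = 1 / 2 := by field_simp

/-- [our object] the inverse-factor constant `CB := 2D·CB0`. -/
def CB (d : ℕ) : ℝ := 2 * ((d : ℝ) + 1) * CB0 d

/-- [folklore] `0 < CB`. -/
theorem CB_pos (d : ℕ) : 0 < CB d := by unfold CB; have := one_le_CB0 d; positivity

/-- [our object] **`Bn` IS INVERTIBLE WITH `‖Bn(k)⁻¹‖_{αβ} ≤ CB d` ON THE THIN STRIP `Strip D κ_C`**, every `n ≥ 1`:
`Bn(k) = Bn(Re k)·(1 + Bn(Re k)⁻¹(En(k) − En(Re k)))`, `Bn_inv_real` + `En_imLipschitz` + Neumann (`CoarseCovarianceStripMatrix.neumann_entry`). -/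
theorem Bn_inv_bound (n : ℕ) [NeZero n] {k : Fin (d + 1) → ℂ} (hk : k ∈ Strip (d + 1) (kapC d)) :
    IsUnit (Bn n k).det ∧ ∀ α β, ‖(Bn n k)⁻¹ α β‖ ≤ CB d := by
  have hD : (0 : ℝ) < (d : ℝ) + 1 := by positivity
  set t := reVec k with ht
  have htBZ : t ∈ BZ (d + 1) := reVec_mem_BZ hk
  obtain ⟨hUt, hBt⟩ := Bn_inv_real n htBZ
  have hLip := En_imLipschitz n (kapC_pos d).le (kapC_le_rA d) hk
  set Δ : Matrix (Fin (d + 1)) (Fin (d + 1)) ℂ := En n k - En n (ofRealVec t) with hΔ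
  set E' : Matrix (Fin (d + 1)) (Fin (d + 1)) ℂ := (Bn n (ofRealVec t))⁻¹ * Δ with hE'
  have hBn : Bn n k = Bn n (ofRealVec t) * (1 + E') := by
    rw [Matrix.mul_add, Matrix.mul_one, hE', ← Matrix.mul_assoc, Matrix.mul_nonsing_inv _ hUt, Matrix.one_mul, hΔ, Bn, Bn]
    abel
  -- the size of `Δ` and of `E'`
  have hΔb : ∀ κ β, ‖Δ κ β‖ ≤ ME d / rA d * (((d : ℝ) + 1) * kapC d) := by
    intro κ β
    rw [hΔ, Matrix.sub_apply]
    refine (hLip κ β).trans (mul_le_mul_of_nonneg_left ?_ (by have := ME_pos d; have := rA_pos d; positivity))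
    calc ∑ i, |(k i).im| ≤ ∑ _i : Fin (d + 1), kapC d := Finset.sum_le_sum fun i _ => (hk i).2
      _ = ((d : ℝ) + 1) * kapC d := by simp only [Finset.sum_const, Finset.card_univ, Fintype.card_fin, nsmul_eq_mul]; push_cast; ring
  set ε : ℝ := ((d : ℝ) + 1) * CB0 d * (ME d / rA d * (((d : ℝ) + 1) * kapC d)) with hε
  have hε0 : 0 ≤ ε := by have := one_le_CB0 d; have := ME_pos d; have := rA_pos d; have := kapC_pos d; positivity
  have hE'b : ∀ α β, ‖E' α β‖ ≤ ε := by
    intro α β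
    rw [hE', Matrix.mul_apply]
    calc _ ≤ ∑ κ, ‖(Bn n (ofRealVec t))⁻¹ α κ * Δ κ β‖ := norm_sum_le _ _
      _ ≤ ∑ _κ : Fin (d + 1), CB0 d * (ME d / rA d * (((d : ℝ) + 1) * kapC d)) := Finset.sum_le_sum fun κ _ => by
          rw [norm_mul]
          exact mul_le_mul (hBt α κ) (hΔb κ β) (norm_nonneg _) (by linarith [one_le_CB0 d])
      _ = ε := by simp only [Finset.sum_const, Finset.card_univ, Fintype.card_fin, nsmul_eq_mul, hε]; push_cast; ring
  have hbudget : ((d + 1 : ℕ) : ℝ) * ε ≤ 1 / 2 := by push_cast; rw [hε]; exact kapC_budget d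
  obtain ⟨hU1, hN⟩ := neumann_entry hε0 hE'b hbudget
  refine ⟨?_, fun α β => ?_⟩
  · rw [hBn, Matrix.det_mul]; exact hUt.mul hU1
  · rw [hBn, Matrix.mul_inv_rev, Matrix.mul_apply]
    calc _ ≤ ∑ κ, ‖(1 + E')⁻¹ α κ * (Bn n (ofRealVec t))⁻¹ κ β‖ := norm_sum_le _ _
      _ ≤ ∑ _κ : Fin (d + 1), 2 * CB0 d := Finset.sum_le_sum fun κ _ => by
          rw [norm_mul]; exact mul_le_mul (hN α κ) (hBt κ β) (norm_nonneg _) (by norm_num)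
      _ = CB d := by simp only [Finset.sum_const, Finset.card_univ, Fintype.card_fin, nsmul_eq_mul, CB]; push_cast; ring

end Summit.QuantumFields.BalabanUV.Beta.FP.CoarseCovarianceStripBn

end
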